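import Literature.NumberTheory.Automorphic.UnitaryGroupLevelBlockDiscreteDecomposition   -- ★ E1 (A-p14 (g26)): the level-`K′` block is discretely decomposable with finite multiplicities
import Literature.NumberTheory.Automorphic.HilbertRepSchur                              -- ★ `IsTopIrreducible.exists_apply_eq_smul_of_commute`
import Literature.NumberTheory.Automorphic.HilbertRepSpectrumProofs                     -- ★ `IsUnitary.adjoint_comp_eq`, `IsTopIrreducible.exists_norm_map_eq_mul`, `ClosedSubrep.ofLinearIsometry`
import Literature.NumberTheory.Automorphic.HilbertRepOrthogonalDecomposition            -- ★ `le_multiplicity_of_pairwise_isOrtho`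
import HarnessLib

/-!
# The level-`K′` block of a closed invariant subspace of `L²([U(J)])` and the bounded `G′_∞`-intertwiners into it:
# Schur coefficients (the unitary-group twin of ★ `CuspidalRepArchIsotypic` §§1, 4)

Topic `NumberTheory/Automorphic`; namespace `Literature.NumberTheory.Automorphic.UnitaryGroup`.  DEFINITIONS WITH BODIES (`levelBlock`, `archIntertwiners`,
`archIntertwinersLevel`, `schurCoeff`) and theorems; no instance, no notation, no named fact, no `sorry`.  Cell `hodgecm-mathlib`, programme P3 «U3-mult», ROAD F
of the (H) block (the letter H3-core = `ArchBlockCore` in-house): FILE F1.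

SETTING (★ `UnitaryGroupAdelicProduct`): `G′ = U(J)` over `F` (`E/F` CM-type quadratic, `c` the involution), `G′(𝔸_F) = G′_∞ × G′(𝔸_{F,f})` with commuting embeddings
`archToAdelic`, `finAdelicToAdelic`; `R` the right regular representation on `L²([G′], μ)`; `W ≤ L²` a closed `G′(𝔸_F)`-invariant subspace; `K′ ≤ G′(𝔸_{F,f})` a subgroup;
`τ` a representation of `G′_∞` on a Hilbert space `E` (an irreducible unitary one in the applications).  This file is the port to `U(J)` of §§1 and 4 of the tree's
`GL_n` file ★ `CuspidalRepArchIsotypic` (seat/lane credited there), with cuspidality replaced later (FILE F2) by compactness of `[G′]` through ★ E1: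

* §1 `levelBlock W K′` — the level piece `W^{K′} = {x ∈ W : R(1,k) x = x ∀ k ∈ K′}` as a closed `G′_∞`-invariant subspace of `L²` for `R ∘ archToAdelic`; membership lemmas;
  `rightRegular_apply_of_finPart_mem` (`R(g) x = R(g_∞) x` on `W^{K′}` when `g_f ∈ K′`).
* §2 `archIntertwiners τ W` (bounded `T : E → L²`, values in `W`, `T ∘ τ(h) = R(h_∞) ∘ T`), `archIntertwinersLevel τ W K′` (values in `W^{K′}`); a non-zero intertwiner out of an
  irreducible `τ` is injective; the adjoint intertwines; **Schur coefficients** `schurCoeff S T` with `T† (S e) = ⟪S|T⟫ e`, `⟪T e′, S e⟫ = ⟪S|T⟫ ⟪e′, e⟫`, `‖T e‖ = r ‖e‖`.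

## References
* A. Borel, H. Jacquet, *Automorphic forms and automorphic representations*, PSPM 33.1 (1979), §4.6 [BorelJacquet1979].
* A. Deitmar, S. Echterhoff, *Principles of Harmonic Analysis*, 2nd ed. (2014), Lemma 6.1.7, Cor. 6.1.9 [DeitmarEchterhoff2014].
* J. Dixmier, *C\*-algebras* (1977), §5.4 [Dixmier1977].
* D. Flath, *Decomposition of representations into tensor products*, PSPM 33.1 (1979), Thm. 4 [FlathCorvallis1979].
-/

set_option autoImplicit false

noncomputable section

open MeasureTheory Measure NumberField Set Filter Topology
open scoped InnerProductSpace

namespace Literature.NumberTheory.Automorphic.UnitaryGroup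

open ContRepresentation (ClosedSubrep AreUnitarilyEquivalent)

variable {F E : Type} [Field F] [NumberField F] [Field E] [NumberField E] [Algebra F E]
  {c : E ≃ₐ[F] E} {N : ℕ} {J : Matrix (Fin N) (Fin N) E}
  {μ : Measure (adelicGroupData F E c N J).automorphicQuotient} [(adelicGroupData F E c N J).IsAutomorphicMeasure μ]

/-! ## §1 The level-`K′` block `W^{K′}` as a closed `G′_∞`-invariant subspace of `L²` -/

section LevelBlock

variable (μ) in
/-- `R ∘ archToAdelic` is unitary. [cite: BorelJacquet1979, §4.6] -/
theorem isUnitary_restrict_archToAdelic : (((adelicGroupData F E c N J).rightRegular μ).restrict (archToAdelic F E c N J)).IsUnitary :=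
  ContRepresentation.IsUnitary.restrict ((adelicGroupData F E c N J).isUnitary_rightRegular μ) (archToAdelic F E c N J)

variable (μ) in
/-- `R ∘ archToAdelic` is strongly continuous. [cite: BorelJacquet1979, §4.6] -/
theorem isStronglyContinuous_restrict_archToAdelic :
    (((adelicGroupData F E c N J).rightRegular μ).restrict (archToAdelic F E c N J)).IsStronglyContinuous :=
  ContRepresentation.IsStronglyContinuous.restrict ((adelicGroupData F E c N J).isStronglyContinuous_rightRegular_holds μ) (archToAdelic F E c N J)
    (continuous_archToAdelic F E c N J)

/-- `R` is multiplicative, as an identity of operators applied (`R (a * b) w = R a (R b w)`). [cite: BorelJacquet1979, §4.6] -/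
theorem rightRegular_mul_apply (a b : (adelicGroupData F E c N J).Adelic) (w : (adelicGroupData F E c N J).L2 μ) :
    (adelicGroupData F E c N J).rightRegular μ (a * b) w = (adelicGroupData F E c N J).rightRegular μ a ((adelicGroupData F E c N J).rightRegular μ b w) := by
  rw [map_mul]; rfl

variable (W : ClosedSubrep ((adelicGroupData F E c N J).rightRegular μ)) (K' : Subgroup (finAdelic F E c N J))

/-- **The level-`K′` block `W^{K′}`** of a closed invariant `W ≤ L²([G′])`: the vectors of `W` fixed by `R(1, k)`, `k ∈ K′`, as a closed `G′_∞`-invariant subspace of `L²`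
for `R ∘ archToAdelic` (`G′_∞` commutes with `G′(𝔸_{F,f})`, ★ `commute_archToAdelic_finAdelicToAdelic`). [cite: BorelJacquet1979, §4.6] -/
def levelBlock : ClosedSubrep (((adelicGroupData F E c N J).rightRegular μ).restrict (archToAdelic F E c N J)) where
  toSubmodule :=
    { carrier := {w | w ∈ W.toSubmodule ∧ ∀ k ∈ K', (adelicGroupData F E c N J).rightRegular μ (finAdelicToAdelic F E c N J k) w = w}
      add_mem' := fun {a b} ha hb => ⟨Submodule.add_mem _ ha.1 hb.1, fun k hk => by rw [map_add, ha.2 k hk, hb.2 k hk]⟩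
      zero_mem' := ⟨Submodule.zero_mem _, fun k _ => map_zero _⟩
      smul_mem' := fun a {w} hw => ⟨Submodule.smul_mem _ a hw.1, fun k hk => by rw [map_smul, hw.2 k hk]⟩ }
  apply_mem_toSubmodule := fun g {w} hw => by
    refine ⟨W.apply_mem (archToAdelic F E c N J g) hw.1, fun k hk => ?_⟩
    change (adelicGroupData F E c N J).rightRegular μ (finAdelicToAdelic F E c N J k)
        ((adelicGroupData F E c N J).rightRegular μ (archToAdelic F E c N J g) w) = (adelicGroupData F E c N J).rightRegular μ (archToAdelic F E c N J g) w
    rw [← rightRegular_mul_apply, ← (commute_archToAdelic_finAdelicToAdelic F E c N J g k).eq, rightRegular_mul_apply, hw.2 k hk]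
  isClosed' := by
    change IsClosed {w : (adelicGroupData F E c N J).L2 μ | w ∈ W.toSubmodule ∧
        ∀ k ∈ K', (adelicGroupData F E c N J).rightRegular μ (finAdelicToAdelic F E c N J k) w = w}
    have h1 : IsClosed {w : (adelicGroupData F E c N J).L2 μ | ∀ k ∈ K', (adelicGroupData F E c N J).rightRegular μ (finAdelicToAdelic F E c N J k) w = w} := by
      have h3 : {w : (adelicGroupData F E c N J).L2 μ | ∀ k ∈ K', (adelicGroupData F E c N J).rightRegular μ (finAdelicToAdelic F E c N J k) w = w} =
          ⋂ k ∈ K', {w | (adelicGroupData F E c N J).rightRegular μ (finAdelicToAdelic F E c N J k) w = w} := by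
        ext w; simp only [Set.mem_setOf_eq, Set.mem_iInter]
      rw [h3]
      exact isClosed_biInter fun k _ => isClosed_eq ((adelicGroupData F E c N J).rightRegular μ _).continuous continuous_id
    rw [Set.setOf_and]
    exact W.isClosed.inter h1

variable {W K'}

/-- Membership in the level block: `x ∈ W` and `R(1, k) x = x` for `k ∈ K′`. [cite: BorelJacquet1979, §4.6] -/
theorem mem_levelBlock_iff {x : (adelicGroupData F E c N J).L2 μ} :
    x ∈ levelBlock W K' ↔ x ∈ W ∧ ∀ k ∈ K', (adelicGroupData F E c N J).rightRegular μ (finAdelicToAdelic F E c N J k) x = x := Iff.rfl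

/-- Elements of the level block lie in `W`. [cite: BorelJacquet1979, §4.6] -/
theorem mem_of_mem_levelBlock {x : (adelicGroupData F E c N J).L2 μ} (hx : x ∈ levelBlock W K') : x ∈ W :=
  ((mem_levelBlock_iff).mp hx).1

/-- The level block is `K′`-fixed vector by vector (the hypothesis shape of ★ E1). [cite: BorelJacquet1979, §4.6] -/
theorem levelBlock_fixed : ∀ w ∈ levelBlock W K', ∀ k ∈ K', (adelicGroupData F E c N J).rightRegular μ (finAdelicToAdelic F E c N J k) w = w :=
  fun _ hw k hk => ((mem_levelBlock_iff).mp hw).2 k hk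

/-- `W^{K′} ≤ W` as subspaces of `L²`. [cite: BorelJacquet1979, §4.6] -/
theorem levelBlock_le : (levelBlock W K').toSubmodule ≤ W.toSubmodule := fun _ hx => mem_of_mem_levelBlock hx

/-- **On the level block `R(g)` acts through the archimedean component** when `g_f ∈ K′`: `R(g) x = R(g_∞) x` (`g = g_∞ · g_f`, ★ `archToAdelic_mul_finAdelicToAdelic`).
[cite: BorelJacquet1979, §4.6] -/
theorem rightRegular_apply_of_finPart_mem {x : (adelicGroupData F E c N J).L2 μ} (hx : x ∈ levelBlock W K') {g : (adelicGroupData F E c N J).Adelic}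
    (hg : finPart F E c N J g ∈ K') :
    (adelicGroupData F E c N J).rightRegular μ g x = (adelicGroupData F E c N J).rightRegular μ (archToAdelic F E c N J (archPart F E c N J g)) x := by
  conv_lhs => rw [← archToAdelic_mul_finAdelicToAdelic F E c N J g, rightRegular_mul_apply, ((mem_levelBlock_iff).mp hx).2 _ hg]

/-- Shrinking the level enlarges the block: `K″ ≤ K′ ⇒ W^{K′} ≤ W^{K″}`. [cite: BorelJacquet1979, §4.6] -/
theorem levelBlock_mono {K'' : Subgroup (finAdelic F E c N J)} (h : K'' ≤ K') : levelBlock W K' ≤ levelBlock W K'' :=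
  fun _ hx => ⟨hx.1, fun k hk => hx.2 k (h hk)⟩

end LevelBlock

/-! ## §2 Bounded `G′_∞`-intertwiners `τ → W` and their Schur coefficients -/

section Intertwiners

variable {E' : Type*} [NormedAddCommGroup E'] [InnerProductSpace ℂ E']
  (τ : ContRepresentation ℂ (arch F E c N J) E')
  (W : ContRepresentation.ClosedSubrep ((adelicGroupData F E c N J).rightRegular μ))

/-- **The bounded `G_∞`-intertwiners `τ → W`**: bounded linear maps `T : E → L²` with values in `W`
intertwining `τ` with the archimedean action `archRegular` on `L²`
(`T (τ(h) e) = R((h, 1)) (T e)`). For `τ` an irreducible unitary representation of `G_∞` occurring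
in a cuspidal `W` these form the multiplicity space `Hom_{G_∞}(τ, W)` on which `GL_n(𝔸_K^∞)` acts
(Borel–Jacquet (1979), §4.6; Flath (1979); Bump (1997), §3.3–3.4, the modules `M_v` / the
archimedean factor `π_∞`). [cite: BorelJacquet1979, §4.6] -/
def archIntertwiners : Submodule ℂ (E' →L[ℂ] (adelicGroupData F E c N J).L2 μ) where
  carrier := {T | (∀ e, T e ∈ W) ∧
    ∀ (h : arch F E c N J) (e : E'), T (τ h e) = (((adelicGroupData F E c N J).rightRegular μ).restrict (archToAdelic F E c N J)) h (T e)}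
  add_mem' := by
    rintro S T ⟨hS, hS'⟩ ⟨hT, hT'⟩
    exact ⟨fun e => W.toSubmodule.add_mem (hS e) (hT e), fun h e => by
      change S (τ h e) + T (τ h e) = (((adelicGroupData F E c N J).rightRegular μ).restrict (archToAdelic F E c N J)) h (S e + T e)
      rw [hS', hT', map_add]⟩
  zero_mem' := ⟨fun _ => W.toSubmodule.zero_mem, fun h e => by simp⟩
  smul_mem' := by
    rintro a T ⟨hT, hT'⟩
    exact ⟨fun e => W.toSubmodule.smul_mem a (hT e), fun h e => by
      change a • T (τ h e) = (((adelicGroupData F E c N J).rightRegular μ).restrict (archToAdelic F E c N J)) h (a • T e)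
      rw [hT', map_smul]⟩

variable (K' : Subgroup (finAdelic F E c N J))

/-- **The bounded `G_∞`-intertwiners `τ → W^{K'}`** (values in the level piece): the multiplicity
space `Hom_{G_∞}(τ, W^{K'})` of `τ` in the level piece. [cite: BorelJacquet1979, §4.6] -/
def archIntertwinersLevel : Submodule ℂ (E' →L[ℂ] (adelicGroupData F E c N J).L2 μ) where
  carrier := {T | T ∈ archIntertwiners τ W ∧ ∀ e, T e ∈ levelBlock W K'}
  add_mem' := by
    rintro S T ⟨hS, hS'⟩ ⟨hT, hT'⟩
    exact ⟨(archIntertwiners τ W).add_mem hS hT,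
      fun e => (levelBlock W K').toSubmodule.add_mem (hS' e) (hT' e)⟩
  zero_mem' := ⟨(archIntertwiners τ W).zero_mem, fun _ => (levelBlock W K').toSubmodule.zero_mem⟩
  smul_mem' := by
    rintro a T ⟨hT, hT'⟩
    exact ⟨(archIntertwiners τ W).smul_mem a hT,
      fun e => (levelBlock W K').toSubmodule.smul_mem a (hT' e)⟩

variable {τ W K'}

/-- Membership in `archIntertwiners`. [cite: DeitmarEchterhoff2014, Lemma 6.1.7 and Cor. 6.1.9] -/
theorem mem_archIntertwiners_iff {T : E' →L[ℂ] (adelicGroupData F E c N J).L2 μ} :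
    T ∈ archIntertwiners τ W ↔ (∀ e, T e ∈ W) ∧
      ∀ (h : arch F E c N J) (e : E'),
        T (τ h e) = (((adelicGroupData F E c N J).rightRegular μ).restrict (archToAdelic F E c N J)) h (T e) := Iff.rfl

/-- Membership in `archIntertwinersLevel`. [cite: DeitmarEchterhoff2014, Lemma 6.1.7 and Cor. 6.1.9] -/
theorem mem_archIntertwinersLevel_iff {T : E' →L[ℂ] (adelicGroupData F E c N J).L2 μ} :
    T ∈ archIntertwinersLevel τ W K' ↔ T ∈ archIntertwiners τ W ∧ ∀ e, T e ∈ levelBlock W K' := Iff.rfl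

/-- `archIntertwinersLevel ≤ archIntertwiners`. [cite: DeitmarEchterhoff2014, Lemma 6.1.7 and Cor. 6.1.9] -/
theorem archIntertwinersLevel_le_archIntertwiners : archIntertwinersLevel τ W K' ≤ archIntertwiners τ W := fun _ h => h.1

/-- The intertwining identity as an identity of operators. [cite: DeitmarEchterhoff2014, Lemma 6.1.7 and Cor. 6.1.9] -/
theorem comp_eq_of_mem_archIntertwiners {T : E' →L[ℂ] (adelicGroupData F E c N J).L2 μ}
    (hT : T ∈ archIntertwiners τ W) (h : arch F E c N J) :
    T ∘L τ h = (((adelicGroupData F E c N J).rightRegular μ).restrict (archToAdelic F E c N J)) h ∘L T :=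
  ContinuousLinearMap.ext fun e => hT.2 h e

/-- **A non-zero intertwiner out of an irreducible representation is injective**: its kernel is a
closed invariant subspace. [cite: DeitmarEchterhoff2014, Lemma 6.1.7 and Cor. 6.1.9] -/
theorem injective_of_mem_archIntertwiners (hτi : τ.IsTopIrreducible)
    {T : E' →L[ℂ] (adelicGroupData F E c N J).L2 μ} (hT : T ∈ archIntertwiners τ W) (hT0 : T ≠ 0) :
    Function.Injective T := by
  -- the kernel as a closed subrepresentation of `τ`
  let Z : ContRepresentation.ClosedSubrep τ :=
    { toSubmodule := LinearMap.ker T.toLinearMap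
      apply_mem_toSubmodule := fun h e he => by
        change T (τ h e) = 0
        rw [hT.2 h e, show T e = 0 from he, map_zero]
      isClosed' := T.isClosed_ker }
  rcases ((ContRepresentation.isTopIrreducible_iff τ).mp hτi).2 Z with hZ | hZ
  · refine (injective_iff_map_eq_zero T).mpr fun e he => ?_
    have : e ∈ Z := he
    rw [hZ, ContRepresentation.ClosedSubrep.mem_bot] at this
    exact this
  · exact (hT0 (ContinuousLinearMap.ext fun e => by
      have : e ∈ Z := hZ ▸ ContRepresentation.ClosedSubrep.mem_top e
      exact this)).elim

/-- For a non-zero intertwiner `T` out of an irreducible `τ` and `e ≠ 0`: `T e ≠ 0`. [cite: DeitmarEchterhoff2014, Lemma 6.1.7 and Cor. 6.1.9] -/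
theorem apply_ne_zero_of_mem_archIntertwiners (hτi : τ.IsTopIrreducible)
    {T : E' →L[ℂ] (adelicGroupData F E c N J).L2 μ} (hT : T ∈ archIntertwiners τ W) (hT0 : T ≠ 0)
    {e : E'} (he : e ≠ 0) : T e ≠ 0 := fun h =>
  he ((injective_of_mem_archIntertwiners hτi hT hT0) (h.trans (map_zero T).symm))

/-- **Evaluation at a non-zero vector is injective on intertwiners** (irreducibility of `τ`).
[cite: DeitmarEchterhoff2014, Lemma 6.1.7 and Cor. 6.1.9] -/
theorem eq_zero_of_apply_eq_zero (hτi : τ.IsTopIrreducible)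
    {T : E' →L[ℂ] (adelicGroupData F E c N J).L2 μ} (hT : T ∈ archIntertwiners τ W)
    {e : E'} (he : e ≠ 0) (h : T e = 0) : T = 0 := by
  by_contra hT0
  exact apply_ne_zero_of_mem_archIntertwiners hτi hT hT0 he h

variable [CompleteSpace E']

/-- **The adjoint of an intertwiner intertwines** (`τ` unitary; `archRegular` is unitary):
`T† (R((h,1)) x) = τ(h) (T† x)` (`IsUnitary.adjoint_comp_eq`). [cite: DeitmarEchterhoff2014, Lemma 6.1.7 and Cor. 6.1.9] -/
theorem adjoint_apply_archRegular {T : E' →L[ℂ] (adelicGroupData F E c N J).L2 μ} (hτ : τ.IsUnitary)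
    (hT : T ∈ archIntertwiners τ W) (h : arch F E c N J)
    (x : (adelicGroupData F E c N J).L2 μ) :
    ContinuousLinearMap.adjoint T ((((adelicGroupData F E c N J).rightRegular μ).restrict (archToAdelic F E c N J)) h x) = τ h (ContinuousLinearMap.adjoint T x) :=
  DFunLike.congr_fun (hτ.adjoint_comp_eq (isUnitary_restrict_archToAdelic μ) (comp_eq_of_mem_archIntertwiners hT) h) x

/-- **Schur's lemma for a pair of intertwiners**: for `τ` irreducible unitary and `S, T : τ → W`
bounded intertwiners, `T† S ∈ End_{G_∞}(τ) = ℂ`, i.e. `T† (S e) = c • e` for one scalar `c`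
(Deitmar–Echterhoff (2014), Lemma 6.1.7 / Cor. 6.1.9; the tree's
`IsTopIrreducible.exists_apply_eq_smul_of_commute`). [cite: DeitmarEchterhoff2014, Cor. 6.1.9] -/
theorem exists_adjoint_comp_apply_eq_smul (hτu : τ.IsUnitary) (hτi : τ.IsTopIrreducible)
    {S T : E' →L[ℂ] (adelicGroupData F E c N J).L2 μ} (hS : S ∈ archIntertwiners τ W)
    (hT : T ∈ archIntertwiners τ W) :
    ∃ a : ℂ, ∀ e : E', ContinuousLinearMap.adjoint T (S e) = a • e := by
  refine hτi.exists_apply_eq_smul_of_commute hτu (T := ContinuousLinearMap.adjoint T ∘L S)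
    fun h => ?_
  ext e
  change τ h (ContinuousLinearMap.adjoint T (S e)) = ContinuousLinearMap.adjoint T (S (τ h e))
  rw [hS.2 h e, adjoint_apply_archRegular hτu hT]

open scoped Classical in
/-- **The Schur coefficient** `⟪S | T⟫` of two intertwiners `S, T : τ → W`: the scalar `c` with
`T† S = c • 1` (junk `0` when there is none; the `∃` is decided classically). It is the sesquilinear form for which
`⟪T e', S e⟫ = ⟪S | T⟫ ⟪e', e⟫`. [cite: DeitmarEchterhoff2014, Lemma 6.1.7 and Cor. 6.1.9] -/
def schurCoeff (S T : E' →L[ℂ] (adelicGroupData F E c N J).L2 μ) : ℂ :=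
  if h : ∃ a : ℂ, ∀ e : E', ContinuousLinearMap.adjoint T (S e) = a • e then h.choose else 0

/-- The defining identity of the Schur coefficient: `T† (S e) = ⟪S | T⟫ • e`. [cite: DeitmarEchterhoff2014, Lemma 6.1.7 and Cor. 6.1.9] -/
theorem adjoint_apply_eq_schurCoeff_smul (hτu : τ.IsUnitary) (hτi : τ.IsTopIrreducible)
    {S T : E' →L[ℂ] (adelicGroupData F E c N J).L2 μ} (hS : S ∈ archIntertwiners τ W)
    (hT : T ∈ archIntertwiners τ W) (e : E') :
    ContinuousLinearMap.adjoint T (S e) = schurCoeff S T • e := by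
  have h := exists_adjoint_comp_apply_eq_smul hτu hτi hS hT
  rw [schurCoeff, dif_pos h]
  exact h.choose_spec e

/-- **Inner products of values of intertwiners**: `⟪T e', S e⟫ = ⟪S | T⟫ ⟪e', e⟫`. [cite: DeitmarEchterhoff2014, Lemma 6.1.7 and Cor. 6.1.9] -/
theorem inner_apply_apply (hτu : τ.IsUnitary) (hτi : τ.IsTopIrreducible)
    {S T : E' →L[ℂ] (adelicGroupData F E c N J).L2 μ} (hS : S ∈ archIntertwiners τ W)
    (hT : T ∈ archIntertwiners τ W) (e e' : E') :
    ⟪T e', S e⟫_ℂ = schurCoeff S T * ⟪e', e⟫_ℂ := by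
  rw [← ContinuousLinearMap.adjoint_inner_right, adjoint_apply_eq_schurCoeff_smul hτu hτi hS hT,
    inner_smul_right]

/-- The Schur coefficient of `T` with itself is `‖T e‖² / ‖e‖²`; in particular real and
non-negative: `⟪T | T⟫ ‖e‖² = ‖T e‖²`. [cite: DeitmarEchterhoff2014, Lemma 6.1.7 and Cor. 6.1.9] -/
theorem schurCoeff_self_mul_norm_sq (hτu : τ.IsUnitary) (hτi : τ.IsTopIrreducible)
    {T : E' →L[ℂ] (adelicGroupData F E c N J).L2 μ} (hT : T ∈ archIntertwiners τ W) (e : E') :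
    schurCoeff T T * ((‖e‖ : ℂ) ^ 2) = ((‖T e‖ : ℂ) ^ 2) := by
  have h := inner_apply_apply hτu hτi hT hT e e
  rw [inner_self_eq_norm_sq_to_K, inner_self_eq_norm_sq_to_K] at h
  exact h.symm

/-- **Intertwiners out of an irreducible unitary representation are multiples of isometries**:
`‖T e‖ = r ‖e‖` for a constant `r ≥ 0` (the tree's `IsTopIrreducible.exists_norm_map_eq_mul`;
Deitmar–Echterhoff (2014), Cor. 6.1.9). [cite: DeitmarEchterhoff2014, Cor. 6.1.9] -/
theorem exists_norm_apply_eq_mul (hτu : τ.IsUnitary) (hτi : τ.IsTopIrreducible)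
    {T : E' →L[ℂ] (adelicGroupData F E c N J).L2 μ} (hT : T ∈ archIntertwiners τ W) :
    ∃ r : ℝ, 0 ≤ r ∧ ∀ e : E', ‖T e‖ = r * ‖e‖ :=
  hτi.exists_norm_map_eq_mul hτu (isUnitary_restrict_archToAdelic μ) (comp_eq_of_mem_archIntertwiners hT)

/-- **Orthogonality of ranges**: if `⟪S | T⟫ = 0` then `T e' ⊥ S e` for all `e, e'`. [cite: DeitmarEchterhoff2014, Lemma 6.1.7 and Cor. 6.1.9] -/
theorem inner_apply_apply_eq_zero (hτu : τ.IsUnitary) (hτi : τ.IsTopIrreducible)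
    {S T : E' →L[ℂ] (adelicGroupData F E c N J).L2 μ} (hS : S ∈ archIntertwiners τ W)
    (hT : T ∈ archIntertwiners τ W) (h0 : schurCoeff S T = 0) (e e' : E') :
    ⟪T e', S e⟫_ℂ = 0 := by
  rw [inner_apply_apply hτu hτi hS hT, h0, zero_mul]

end Intertwiners


/-! ### 5. The multiplicity space `Hom_{G_∞}(τ, W^{K'})` is finite-dimensional, with a Schur-orthonormal
basis (finite multiplicities in the level piece) -/

end Literature.NumberTheory.Automorphic.UnitaryGroup

end
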